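import Literature.NumberTheory.EllipticCurves.SerreOpenImageOrdinaryReductionProofs
import Mathlib.Algebra.Polynomial.Splits
import HarnessLib

/-!
# Valuations of the `ℓ`-torsion abscissae at a good supersingular prime (Serre 1972, §1.11)

Topic `NumberTheory/EllipticCurves`.  Theorems only (nothing is defined, no named fact).  Let
`E = W/ℚ` be in global minimal form, `ℓ` an odd prime of good **supersingular** reduction
(`ℓ ∣ a_ℓ`), `𝒪 = 𝒪_𝔓 ⊂ ℚ̄` the place of the tree over `ℓ` (`placeOver ℓ`) with valuation `v`
(written multiplicatively, `v(ℓ) < 1`), and `d = (ℓ² - 1)/2`.  We prove the valuation-theoretic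
content of J.-P. Serre, Invent. Math. 15 (1972), §1.11, Prop. 12 (case `e = 1`, "bonne réduction
de hauteur 2": the points of `E[ℓ]` have parameter of valuation `1/(ℓ² - 1)`), in the elementary
form in which it will be used to compute the image of inertia (Prop. 12 c)):

* `geomReduction_eq_zero_of_dvd_frobeniusTrace` — the reduction map kills `E[ℓ]` (`Ẽ[ℓ] = 0`,
  the tree's `forall_nsmul_ne_zero_of_dvd_trace`), so (`one_lt_valuation_of_zsmul_eq_zero`) the
  abscissa of a nonzero `ℓ`-torsion point is not `𝔓`-integral;
* `natDegree_preΨ'_reductionModPrime_eq_zero`, `preΨ'_reductionModPrime_ne_zero` — the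
  reduction modulo `ℓ` of the `ℓ`-division polynomial `ψ_ℓ ∈ ℤ[X]` of the minimal model is a
  **nonzero constant** (a root downstairs would lift to an integral torsion abscissa by the root
  lifting of `SerreOpenImageOrdinaryReductionProofs`); hence (`dvd_coeff_preΨ'`,
  `not_dvd_coeff_preΨ'_zero`) `ℓ` divides every coefficient of `ψ_ℓ` of positive degree and not
  the constant one, while the leading coefficient is `ℓ` in degree `d` (Mathlib);
* `valuation_pow_mul_eq_one_of_isRoot` — consequently every root `x` of `ψ_ℓ` in `ℚ̄` (so every
  abscissa of a nonzero `ℓ`-torsion point, `isRoot_preΨ'_of_zsmul_eq_zero`) satisfies `v(x) > 1`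
  and `v(x)^d · v(ℓ) = 1` ("`v(x) = -2/(ℓ² - 1)`": the Newton polygon of `ψ_ℓ` is a single
  segment);
* `valuation_sub_eq_of_isRoot` — and two distinct roots are never closer than their size:
  `v(x - x') = v(x)` (computed from `ψ_ℓ'(x) = ℓ ∏ (x - x')` and the termwise valuation of
  `ψ_ℓ'(x)`, using `ℓ ∤ d`).

## References

* [Serre1972] J.-P. Serre, Invent. Math. 15 (1972) 259–331, §1.10 (Prop. 10), §1.11 (Prop. 12).
* [SilvermanAEC2009] J. H. Silverman, *The Arithmetic of Elliptic Curves*, 2nd ed. (2009),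
  Ex. 3.7, Thm. V.3.1(a), VII.§2–3 (and Thm. IV.6.1 / IV.7.2 for the formal-group version).
-/

noncomputable section

open scoped Classical
open Polynomial WeierstrassCurve

namespace Literature.NumberTheory.EllipticCurves

/-! ### Ordered-group helpers -/

section Order

variable {Γ₀ : Type*} [LinearOrderedCommGroupWithZero Γ₀]

/-- Strict monotonicity of multiplication by a nonzero element. [folklore] -/
theorem mul_lt_mul_left_of_ne_zero {a b c : Γ₀} (hc : c ≠ 0) (h : a < b) : c * a < c * b :=
  lt_of_le_of_ne (by gcongr) fun e ↦ h.ne (mul_left_cancel₀ hc e)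

/-- `1 < a ⇒ 1 < a ^ (k + 1)`. [folklore] -/
theorem one_lt_pow_succ_of_one_lt {a : Γ₀} (ha : 1 < a) : ∀ k : ℕ, 1 < a ^ (k + 1)
  | 0 => by simpa using ha
  | k + 1 => by
    calc (1 : Γ₀) < a ^ (k + 1) := one_lt_pow_succ_of_one_lt ha k
      _ = a ^ (k + 1) * 1 := (mul_one _).symm
      _ ≤ a ^ (k + 1) * a := mul_le_mul' le_rfl ha.le
      _ = a ^ (k + 1 + 1) := (pow_succ _ _).symm

/-- `a < b ⇒ a ^ (k + 1) < b ^ (k + 1)`. [folklore] -/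
theorem pow_succ_lt_pow_succ_of_lt {a b : Γ₀} (hab : a < b) : ∀ k : ℕ, a ^ (k + 1) < b ^ (k + 1)
  | 0 => by simpa using hab
  | k + 1 => by
    have hb0 : b ≠ 0 := by rintro rfl; exact not_lt_zero hab
    calc a ^ (k + 1 + 1) = a ^ (k + 1) * a := pow_succ a _
      _ ≤ b ^ (k + 1) * a := mul_le_mul' (pow_succ_lt_pow_succ_of_lt hab k).le le_rfl
      _ < b ^ (k + 1) * b := mul_lt_mul_left_of_ne_zero (pow_ne_zero _ hb0) hab
      _ = b ^ (k + 1 + 1) := (pow_succ b _).symm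

/-- `a ↦ a ^ n` is injective for `n ≠ 0`. [folklore] -/
theorem pow_left_injective_of_ne_zero {a b : Γ₀} {n : ℕ} (hn : n ≠ 0) (h : a ^ n = b ^ n) :
    a = b := by
  obtain ⟨k, rfl⟩ := Nat.exists_eq_succ_of_ne_zero hn
  rcases lt_trichotomy a b with hab | hab | hab
  · exact absurd h (pow_succ_lt_pow_succ_of_lt hab k).ne
  · exact hab
  · exact absurd h (pow_succ_lt_pow_succ_of_lt hab k).ne'

end Order

variable (ℓ : ℕ) [Fact ℓ.Prime] {W : WeierstrassCurve ℚ} [W.IsGloballyMinimal]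

/-! ### Supersingular reduction kills `E[ℓ]` -/

/-- **Supersingular: `red(E[ℓ]) = 0`.**  If `ℓ ∣ a_ℓ(W)` (good supersingular reduction) then
every `ℓ`-torsion point of `E(ℚ̄)` reduces to `Õ`, because `Ẽ(𝔽̄_ℓ)` has no point of order `ℓ`
(the tree's `forall_nsmul_ne_zero_of_dvd_trace`, Silverman *AEC* V.3.1(a)). Serre 1972, §1.11
("hauteur 2": `Ẽ_p = 0`). [cite: Serre1972, §1.11] [cite: SilvermanAEC2009, Thm. V.3.1(a)] -/
theorem geomReduction_eq_zero_of_dvd_frobeniusTrace (hΔ : ¬ (ℓ : ℤ) ∣ minimalDiscriminantInt W)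
    (hss : (ℓ : ℤ) ∣ W.frobeniusTrace ℓ) {P : W.geomPoints} (hP : (ℓ : ℤ) • P = 0) :
    geomReduction hΔ P = 0 := by
  haveI : (reductionModPrime W ℓ).IsElliptic := isElliptic_reductionModPrime W hΔ
  obtain ⟨σ, hσ⟩ := WeierstrassCurve.exists_frobenius_absoluteGaloisGroup (ZMod ℓ)
  have ha : (ℓ : ℤ) ∣ (Nat.card (ZMod ℓ) : ℤ) + 1 -
      Nat.card (reductionModPrime W ℓ).toAffine.Point := by
    rw [Nat.card_zmod, ← frobeniusTrace_eq_sub_natCard_reductionModPrime]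
    exact hss
  by_contra hQ
  refine (reductionModPrime W ℓ).forall_nsmul_ne_zero_of_dvd_trace ℓ hσ ha _ hQ ?_
  rw [← natCast_zsmul, ← map_zsmul, hP, map_zero]

/-- Hence **the abscissa of a nonzero `ℓ`-torsion point is not `𝔓`-integral** at a good
supersingular `ℓ` (an integral point reduces to an affine point `≠ Õ`). Serre 1972, §1.11
(`E_p ⊂ E₁`). [cite: Serre1972, §1.11] -/
theorem one_lt_valuation_of_zsmul_eq_zero [W.IsElliptic]
    (hΔ : ¬ (ℓ : ℤ) ∣ minimalDiscriminantInt W) (hss : (ℓ : ℤ) ∣ W.frobeniusTrace ℓ)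
    {P : W.geomPoints} (hP : (ℓ : ℤ) • P = 0) {x y : AlgebraicClosure ℚ} {h}
    (hPxy : P = .some x y h) : 1 < (placeOver ℓ).valuation x := by
  by_contra hx
  rw [not_lt, ValuationSubring.valuation_le_one_iff] at hx
  have heq : ((placeModel ℓ W).baseChange (AlgebraicClosure ℚ)).toAffine.Equation x y := by
    rw [placeModel_baseChange]; exact h.left
  have hy1 : (placeOver ℓ).valuation y ≤ 1 :=
    v_Y_le_one_of_v_X_le_one (W := placeModel ℓ W) (integers_placeOver ℓ) heq
      ((ValuationSubring.valuation_le_one_iff _ _).mpr hx)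
  have hy : y ∈ placeOver ℓ := (ValuationSubring.valuation_le_one_iff _ _).mp hy1
  set a : placeOver ℓ := ⟨x, hx⟩ with ha
  set b : placeOver ℓ := ⟨y, hy⟩ with hb
  obtain ⟨h', hred⟩ := geomReduction_some_coe hΔ a b h
  have h0 := geomReduction_eq_zero_of_dvd_frobeniusTrace ℓ hΔ hss hP
  rw [hPxy] at h0
  change geomReduction hΔ (.some (a : AlgebraicClosure ℚ) b h) = 0 at h0
  rw [hred] at h0
  exact Affine.Point.some_ne_zero h' h0

/-! ### The `ℓ`-division polynomial modulo `ℓ` is a nonzero constant -/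

/-- **`ψ_ℓ mod ℓ ≠ 0`** (for an elliptic curve over `𝔽̄_ℓ`, `ΨSq_ℓ = 0` would make every point
`ℓ`-torsion, including the `(ℓ+1)²` points of `Ẽ[ℓ+1]`, Silverman *AEC* III.6.4(b)).
[cite: SilvermanAEC2009, Cor. III.6.4(b) and Ex. 3.7] -/
theorem preΨ'_reductionModPrime_ne_zero (hΔ : ¬ (ℓ : ℤ) ∣ minimalDiscriminantInt W) :
    (reductionModPrime W ℓ).preΨ' ℓ ≠ 0 := by
  haveI : (reductionModPrime W ℓ).IsElliptic := isElliptic_reductionModPrime W hΔ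
  set Ebar := (reductionModPrime W ℓ).baseChange (AlgebraicClosure (ZMod ℓ)) with hEbar
  intro h0
  have hΨ : Ebar.ΨSq ℓ = 0 := by
    rw [hEbar, baseChange, map_ΨSq, ΨSq_ofNat, h0, zero_pow two_ne_zero, zero_mul,
      Polynomial.map_zero]
  have hp : ℓ.Prime := Fact.out
  have hp1 : ((ℓ + 1 : ℕ) : AlgebraicClosure (ZMod ℓ)) ≠ 0 := by
    rw [Nat.cast_succ, CharP.cast_eq_zero (AlgebraicClosure (ZMod ℓ)) ℓ, zero_add]
    exact one_ne_zero
  have hcard := card_torsionBy_eq_sq (E := Ebar) hp1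
  haveI : Finite (AddSubgroup.torsionBy Ebar.toAffine.Point ((ℓ + 1 : ℕ) : ℤ)) :=
    Nat.finite_of_card_ne_zero (by rw [hcard]; positivity)
  have h1 : 1 < Nat.card (AddSubgroup.torsionBy Ebar.toAffine.Point ((ℓ + 1 : ℕ) : ℤ)) := by
    rw [hcard]
    nlinarith [hp.two_le]
  haveI := (Finite.one_lt_card_iff_nontrivial.mp h1)
  obtain ⟨⟨R, hR⟩, hR0⟩ :=
    exists_ne (0 : AddSubgroup.torsionBy Ebar.toAffine.Point ((ℓ + 1 : ℕ) : ℤ))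
  have hR' : ((ℓ + 1 : ℕ) : ℤ) • R = 0 := (Submodule.mem_torsionBy_iff _ _).mp hR
  rcases R with _ | ⟨u', w', h'⟩
  · exact hR0 (Subtype.ext rfl)
  · have hpR : (ℓ : ℤ) • (Affine.Point.some u' w' h' : Ebar.toAffine.Point) = 0 := by
      rw [zsmul_some_eq_zero_iff_eval_ΨSq Ebar h', hΨ, eval_zero]
    have h1R : (1 : ℤ) • (Affine.Point.some u' w' h' : Ebar.toAffine.Point) = 0 := by
      rw [show (1 : ℤ) = ((ℓ + 1 : ℕ) : ℤ) - ℓ by push_cast; ring, sub_zsmul, hR', hpR]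
      simp
    rw [one_zsmul] at h1R
    exact Affine.Point.some_ne_zero h' h1R

section DivisionPolynomial

variable [W.IsElliptic] (hΔ : ¬ (ℓ : ℤ) ∣ minimalDiscriminantInt W)
  (hss : (ℓ : ℤ) ∣ W.frobeniusTrace ℓ)
include hΔ hss

/-- **`ψ_ℓ mod ℓ` has no root: it is a constant.**  At a good supersingular prime the reduction
of the univariate `ℓ`-division polynomial `ψ_ℓ = preΨ'_ℓ` of the minimal model has degree `0`:
a root in `𝔽̄_ℓ` would lift (root lifting over the algebraically closed valued field `ℚ̄`,
`exists_isRoot_of_natDegree_map_residue_ne_zero`) to a `𝔓`-integral root `a` of `ψ_ℓ`, i.e. to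
an `ℓ`-torsion point `(a, b)` with integral abscissa, which does not reduce to `Õ` — contradicting
`geomReduction_eq_zero_of_dvd_frobeniusTrace`. [cite: Serre1972, §1.11] -/
theorem natDegree_preΨ'_reductionModPrime_eq_zero :
    ((reductionModPrime W ℓ).preΨ' ℓ).natDegree = 0 := by
  haveI : (reductionModPrime W ℓ).IsElliptic := isElliptic_reductionModPrime W hΔ
  set O := placeOver ℓ with hO
  set M := placeModel ℓ W with hM
  set r := placeResidueMap ℓ with hr
  set Ebar := (reductionModPrime W ℓ).baseChange (AlgebraicClosure (ZMod ℓ)) with hEbar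
  have hcurve : M.map r = Ebar := placeModel_map_placeResidueMap ℓ W
  set F : O[X] := M.preΨ' ℓ with hFdef
  have hFr : F.map r = Ebar.preΨ' ℓ := by rw [← hcurve, map_preΨ']
  by_contra hdeg
  -- the reduction of `F` along the residue map of `O` is not constant either
  have hdeg' : (F.map (IsLocalRing.residue O)).natDegree ≠ 0 := by
    have hcomp : r = (placeResidueEmb ℓ).comp (IsLocalRing.residue O) :=
      RingHom.ext (placeResidueMap_apply ℓ)
    have h1 : (Ebar.preΨ' ℓ).natDegree ≠ 0 := by
      have : Ebar.preΨ' ℓ = ((reductionModPrime W ℓ).preΨ' ℓ).map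
          (algebraMap (ZMod ℓ) (AlgebraicClosure (ZMod ℓ))) := by
        rw [hEbar, baseChange, map_preΨ']
      rwa [this, natDegree_map_eq_of_injective (algebraMap (ZMod ℓ) _).injective]
    rwa [← hFr, hcomp, ← Polynomial.map_map,
      natDegree_map_eq_of_injective (placeResidueEmb ℓ).injective] at h1
  -- an integral root `a` of `ψ_ℓ`, an integral `b` over it
  obtain ⟨a, ha⟩ := exists_isRoot_of_natDegree_map_residue_ne_zero O F hdeg'
  set c₁ : O := M.a₁ * a + M.a₃ with hc₁
  set c₀ : O := a ^ 3 + M.a₂ * a ^ 2 + M.a₄ * a + M.a₆ with hc₀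
  have hlt2 : (C c₁ * X - C c₀).degree < ((2 : ℕ) : WithBot ℕ) :=
    (degree_sub_le _ _).trans_lt
      (max_lt ((degree_C_mul_X_le _).trans_lt (by decide)) (degree_C_le.trans_lt (by decide)))
  have hlt : (C c₁ * X - C c₀).degree < (X ^ 2 : O[X]).degree := by
    rwa [degree_X_pow]
  have hqm : (X ^ 2 + (C c₁ * X - C c₀) : O[X]).Monic := monic_X_pow_add hlt2
  have hqdeg : 0 < (X ^ 2 + (C c₁ * X - C c₀) : O[X]).natDegree := by
    rw [natDegree_add_eq_left_of_degree_lt hlt, natDegree_X_pow]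
    exact two_pos
  obtain ⟨b, hb⟩ := exists_eval_eq_zero_placeOver ℓ hqm hqdeg
  have hrootb : b ^ 2 + c₁ * b - c₀ = 0 := by
    have : b ^ 2 + (c₁ * b - c₀) = 0 := by
      simpa only [eval_add, eval_sub, eval_pow, eval_mul, eval_X, eval_C] using hb
    linear_combination this
  have hab : b ^ 2 + (M.a₁ * a + M.a₃) * b = a ^ 3 + M.a₂ * a ^ 2 + M.a₄ * a + M.a₆ := by
    rw [hc₁, hc₀] at hrootb
    linear_combination hrootb
  have hns := nonsingular_coe_of_eval_eq (W := W) hab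
  -- `P = (a, b)` is `ℓ`-torsion (`ΨSq_ℓ = ψ_ℓ² · 1` vanishes at `a`) with reduction `(ā, b̄) ≠ Õ`
  have htors : (ℓ : ℤ) • (Affine.Point.some _ _ hns) = 0 := by
    refine (zsmul_some_eq_zero_iff_eval_ΨSq _ hns ℓ).mpr ?_
    rw [← placeModel_baseChange ℓ W]
    change ((M.map (algebraMap O (AlgebraicClosure ℚ))).ΨSq ℓ).eval
      (algebraMap O (AlgebraicClosure ℚ) a) = 0
    rw [map_ΨSq, eval_map, eval₂_at_apply, ΨSq_ofNat, eval_mul, eval_pow, ← hFdef, ha.eq_zero,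
      zero_pow two_ne_zero, zero_mul, map_zero]
  obtain ⟨h', hred⟩ := geomReduction_some_coe hΔ a b hns
  have h0 := geomReduction_eq_zero_of_dvd_frobeniusTrace ℓ hΔ hss htors
  rw [hred] at h0
  exact Affine.Point.some_ne_zero h' h0

/-- **`ℓ` divides all coefficients of `ψ_ℓ` of positive degree** (the integral `ℓ`-division
polynomial `preΨ'_ℓ` of the minimal model `integralModelInt W`), at a good supersingular prime
`ℓ`: its reduction is a constant. [cite: Serre1972, §1.11] -/
theorem dvd_coeff_preΨ' {i : ℕ} (hi : i ≠ 0) :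
    (ℓ : ℤ) ∣ ((integralModelInt W).preΨ' ℓ).coeff i := by
  haveI : NeZero ℓ := ⟨(Fact.out : ℓ.Prime).ne_zero⟩
  have hdeg := natDegree_preΨ'_reductionModPrime_eq_zero ℓ hΔ hss
  have hmap : (reductionModPrime W ℓ).preΨ' ℓ =
      ((integralModelInt W).preΨ' ℓ).map (Int.castRingHom (ZMod ℓ)) := by
    rw [reductionModPrime, map_preΨ']
  have hci : ((reductionModPrime W ℓ).preΨ' ℓ).coeff i = 0 := by
    rw [eq_C_of_natDegree_eq_zero hdeg, coeff_C, if_neg hi]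
  rw [hmap, coeff_map, eq_intCast] at hci
  exact (ZMod.intCast_zmod_eq_zero_iff_dvd _ ℓ).mp hci

/-- **… and not the constant coefficient** (`ψ_ℓ mod ℓ` is a *nonzero* constant).
[cite: Serre1972, §1.11] -/
theorem not_dvd_coeff_preΨ'_zero : ¬ (ℓ : ℤ) ∣ ((integralModelInt W).preΨ' ℓ).coeff 0 := by
  haveI : NeZero ℓ := ⟨(Fact.out : ℓ.Prime).ne_zero⟩
  have hdeg := natDegree_preΨ'_reductionModPrime_eq_zero ℓ hΔ hss
  have hne := preΨ'_reductionModPrime_ne_zero ℓ hΔ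
  have hmap : (reductionModPrime W ℓ).preΨ' ℓ =
      ((integralModelInt W).preΨ' ℓ).map (Int.castRingHom (ZMod ℓ)) := by
    rw [reductionModPrime, map_preΨ']
  intro hdvd
  apply hne
  rw [eq_C_of_natDegree_eq_zero hdeg, hmap, coeff_map, eq_intCast,
    (ZMod.intCast_zmod_eq_zero_iff_dvd _ ℓ).mpr hdvd, C_0]

end DivisionPolynomial

/-! ### Valuations of the roots of `ψ_ℓ` -/

section Roots

variable [W.IsElliptic]

omit [W.IsElliptic] in
/-- `ℓ` odd: `ψ_ℓ` has degree `d = (ℓ² - 1)/2` and leading coefficient `ℓ` (Mathlib's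
`natDegree_preΨ'`, `coeff_preΨ'`), also after mapping to `ℚ̄`. [folklore] -/
theorem natDegree_preΨ'_map_eq (hℓ2 : ℓ ≠ 2) :
    (((integralModelInt W).preΨ' ℓ).map (Int.castRingHom (AlgebraicClosure ℚ))).natDegree =
      (ℓ ^ 2 - 1) / 2 ∧
    (((integralModelInt W).preΨ' ℓ).map (Int.castRingHom (AlgebraicClosure ℚ))).coeff
      ((ℓ ^ 2 - 1) / 2) = ℓ := by
  have hp : ℓ.Prime := Fact.out
  have hodd : ¬ Even ℓ := fun h ↦ hℓ2 ((hp.even_iff).mp h)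
  have hℓ0 : ((ℓ : ℕ) : ℤ) ≠ 0 := by exact_mod_cast hp.ne_zero
  have hd := (integralModelInt W).natDegree_preΨ' (n := ℓ) hℓ0
  have hc := (integralModelInt W).coeff_preΨ' ℓ
  simp only [if_neg hodd] at hd hc
  refine ⟨?_, ?_⟩
  · rw [natDegree_map_eq_of_injective (Int.castRingHom (AlgebraicClosure ℚ)).injective_int, hd]
  · rw [coeff_map, hc, eq_intCast, Int.cast_natCast]

/-- **The Newton polygon of `ψ_ℓ` at a good supersingular `ℓ` is a segment: every root `x ∈ ℚ̄`
of `ψ_ℓ` has `v(x) > 1` and `v(x)^d · v(ℓ) = 1`, `d = (ℓ² - 1)/2`** ("the nonzero points of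
`E[ℓ]` have parameter `t = -x/y` of valuation `1/(ℓ² - 1)`", Serre 1972, §1.10–1.11, Prop. 10
and Prop. 12 for `e = 1`; here from `ψ_ℓ ≡ c ≠ 0 (mod ℓ)` coefficientwise and the leading
coefficient `ℓ`: in `∑ cᵢ xⁱ = 0` the term `c_d x^d` dominates all middle terms and must cancel
the unit `c₀`). [cite: Serre1972, §1.11 Prop. 12] -/
theorem valuation_pow_mul_eq_one_of_isRoot (hΔ : ¬ (ℓ : ℤ) ∣ minimalDiscriminantInt W)
    (hss : (ℓ : ℤ) ∣ W.frobeniusTrace ℓ) (hℓ2 : ℓ ≠ 2) {x : AlgebraicClosure ℚ}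
    (hx : (((integralModelInt W).preΨ' ℓ).map (Int.castRingHom (AlgebraicClosure ℚ))).IsRoot x) :
    1 < (placeOver ℓ).valuation x ∧
      (placeOver ℓ).valuation x ^ ((ℓ ^ 2 - 1) / 2) * (placeOver ℓ).valuation ℓ = 1 := by
  have hp : ℓ.Prime := Fact.out
  set v := (placeOver ℓ).valuation with hv
  set F := ((integralModelInt W).preΨ' ℓ).map (Int.castRingHom (AlgebraicClosure ℚ)) with hF
  set d := (ℓ ^ 2 - 1) / 2 with hd
  obtain ⟨hdeg, hlead⟩ := natDegree_preΨ'_map_eq ℓ (W := W) hℓ2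
  have hdegF : F.natDegree = d := by rw [hF, hd]; exact hdeg
  have hd1 : 1 ≤ d := by
    have h3 : 3 ≤ ℓ := by have := hp.two_le; omega
    have : 8 ≤ ℓ ^ 2 - 1 := by
      have : 9 ≤ ℓ ^ 2 := by nlinarith
      omega
    rw [hd]; omega
  -- valuations of the coefficients
  have hvℓ : v ℓ < 1 := valuation_placeOver_natCast_lt_one ℓ
  have hvℓ0 : v ℓ ≠ 0 := by
    rw [hv, Valuation.ne_zero_iff]; exact_mod_cast hp.ne_zero
  have hcoeff : ∀ i, F.coeff i = (((integralModelInt W).preΨ' ℓ).coeff i : AlgebraicClosure ℚ) :=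
    fun i ↦ by rw [hF, coeff_map, eq_intCast]
  have hvi : ∀ i, i ≠ 0 → v (F.coeff i) ≤ v ℓ := by
    intro i hi
    obtain ⟨m, hm⟩ := dvd_coeff_preΨ' ℓ hΔ hss hi
    rw [hcoeff, hm, Int.cast_mul, Int.cast_natCast, map_mul]
    conv_rhs => rw [← mul_one (v ℓ)]
    gcongr
    rcases em ((ℓ : ℤ) ∣ m) with h | h
    · exact ((valuation_placeOver_intCast_lt_one_iff ℓ).mpr h).le
    · exact (valuation_placeOver_intCast_eq_one ℓ h).le
  have hv0 : v (F.coeff 0) = 1 := by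
    rw [hcoeff]
    exact valuation_placeOver_intCast_eq_one ℓ (not_dvd_coeff_preΨ'_zero ℓ hΔ hss)
  have hvd : v (F.coeff d) = v ℓ := by rw [hlead]
  -- the equation `∑_{i ≤ d} cᵢ xⁱ = 0`, split as `c₀ + (middle) + c_d x^d`
  have hsum : ∑ i ∈ Finset.range (d + 1), F.coeff i * x ^ i = 0 := by
    rw [← hdegF, ← eval_eq_sum_range]; exact hx
  obtain ⟨d', hd'⟩ : ∃ d', d = d' + 1 := ⟨d - 1, by omega⟩
  have hsplit : ∑ i ∈ Finset.range (d + 1), F.coeff i * x ^ i =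
      F.coeff 0 + (∑ i ∈ Finset.range d', F.coeff (i + 1) * x ^ (i + 1)) + F.coeff d * x ^ d := by
    rw [Finset.sum_range_succ, hd', Finset.sum_range_succ', pow_zero, mul_one,
      add_comm (∑ i ∈ _, _)]
  rw [hsplit] at hsum
  -- (1) `v x > 1`
  have hx1 : 1 < v x := by
    by_contra hle
    rw [not_lt] at hle
    have hmid : v ((∑ i ∈ Finset.range d', F.coeff (i + 1) * x ^ (i + 1)) + F.coeff d * x ^ d) <
        1 := by
      refine Valuation.map_add_lt _ (Valuation.map_sum_lt _ one_ne_zero fun i _ ↦ ?_) ?_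
      · rw [map_mul, map_pow]
        calc v (F.coeff (i + 1)) * v x ^ (i + 1) ≤ v ℓ * 1 := by
              gcongr
              · exact hvi _ i.succ_ne_zero
              · exact pow_le_one₀ zero_le hle
          _ < 1 := by rwa [mul_one]
      · rw [map_mul, map_pow, hvd]
        calc v ℓ * v x ^ d ≤ v ℓ * 1 := by gcongr; exact pow_le_one₀ zero_le hle
          _ < 1 := by rwa [mul_one]
    have hall : v (F.coeff 0 + ((∑ i ∈ Finset.range d', F.coeff (i + 1) * x ^ (i + 1)) +
        F.coeff d * x ^ d)) = 1 := by
      rw [Valuation.map_add_eq_of_lt_left _ (by rwa [hv0]), hv0]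
    rw [add_assoc] at hsum
    rw [hsum, map_zero] at hall
    exact zero_ne_one hall
  refine ⟨hx1, ?_⟩
  -- (2) the middle terms are dominated by `c_d x^d`
  have hxne : v x ≠ 0 := by rintro h; rw [h] at hx1; exact not_lt_zero hx1
  have hdom : v (∑ i ∈ Finset.range d', F.coeff (i + 1) * x ^ (i + 1)) < v (F.coeff d * x ^ d) := by
    rw [map_mul, map_pow, hvd]
    refine Valuation.map_sum_lt _ (mul_ne_zero hvℓ0 (pow_ne_zero _ hxne)) fun i hi ↦ ?_
    rw [Finset.mem_range] at hi
    rw [map_mul, map_pow]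
    calc v (F.coeff (i + 1)) * v x ^ (i + 1) ≤ v ℓ * v x ^ (i + 1) := by
          gcongr; exact hvi _ i.succ_ne_zero
      _ < v ℓ * v x ^ d := mul_lt_mul_left_of_ne_zero hvℓ0 (pow_lt_pow_right₀ hx1 (by omega))
  have hsum' : F.coeff d * x ^ d + (∑ i ∈ Finset.range d', F.coeff (i + 1) * x ^ (i + 1)) =
      -F.coeff 0 := by
    rw [add_assoc] at hsum
    linear_combination hsum
  have key : v (F.coeff d * x ^ d) = 1 := by
    rw [← Valuation.map_add_eq_of_lt_left _ hdom, hsum', Valuation.map_neg, hv0]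
  rw [map_mul, map_pow, hvd, mul_comm] at key
  exact key

omit [W.IsElliptic] in
/-- The abscissa of a nonzero `ℓ`-torsion point is a root of `ψ_ℓ` (`ΨSq_ℓ = ψ_ℓ²` for `ℓ` odd,
and `[ℓ]P = O ↔ ΨSq_ℓ(x(P)) = 0`, the tree's `zsmul_some_eq_zero_iff_eval_ΨSq`, Silverman *AEC*
Ex. 3.7). [cite: SilvermanAEC2009, Exercise 3.7(d),(f)] -/
theorem isRoot_preΨ'_of_zsmul_eq_zero (hℓ2 : ℓ ≠ 2) {P : W.geomPoints} (hP : (ℓ : ℤ) • P = 0)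
    {x y : AlgebraicClosure ℚ} {h} (hPxy : P = .some x y h) :
    (((integralModelInt W).preΨ' ℓ).map (Int.castRingHom (AlgebraicClosure ℚ))).IsRoot x := by
  have hp : ℓ.Prime := Fact.out
  have hodd : ¬ Even ℓ := fun h ↦ hℓ2 ((hp.even_iff).mp h)
  subst hPxy
  have hΨ := (zsmul_some_eq_zero_iff_eval_ΨSq _ h ℓ).mp hP
  -- `W_{ℚ̄}` (the curve underlying `W.geomPoints`) is `integralModelInt W` read in `ℚ̄`
  have e : @WeierstrassCurve.baseChange ℚ _ W (AlgebraicClosure ℚ) _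
        (@AlgebraicClosure.instAlgebra ℚ _ ℚ _ _) =
      (integralModelInt W).map (Int.castRingHom (AlgebraicClosure ℚ)) := by
    conv_lhs => rw [← map_integralModelInt W]
    rw [baseChange, WeierstrassCurve.map_map]
    exact congrArg (integralModelInt W).map (RingHom.ext_int _ _)
  rw [e, ΨSq_ofNat, if_neg hodd, mul_one, map_preΨ', eval_pow] at hΨ
  exact (pow_eq_zero_iff two_ne_zero).mp hΨ

/-- **Distinct roots of `ψ_ℓ` are far apart: `v(x - x') = v(x)`** for roots `x ≠ x'` of `ψ_ℓ` in
`ℚ̄`, at a good supersingular odd prime `ℓ`.  From `ψ_ℓ = ℓ ∏ (X - xⱼ)` (it splits in `ℚ̄`):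
`ψ_ℓ'(x) = ℓ ∏_{j} (x - xⱼ)` over the other roots, each factor of valuation `≤ v(x)` (all roots
have the same valuation); and termwise `v(ψ_ℓ'(x)) = v(d ℓ x^{d-1}) = v(ℓ) v(x)^{d-1}` since
`ℓ ∤ d`.  So no factor can be smaller than `v(x)`. (This is the separability of the reduction of
the rescaled polynomial, i.e. of `Y^d - u`.) [cite: Serre1972, §1.11 Prop. 12] -/
theorem valuation_sub_eq_of_isRoot (hΔ : ¬ (ℓ : ℤ) ∣ minimalDiscriminantInt W)
    (hss : (ℓ : ℤ) ∣ W.frobeniusTrace ℓ) (hℓ2 : ℓ ≠ 2) {x x' : AlgebraicClosure ℚ}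
    (hx : (((integralModelInt W).preΨ' ℓ).map (Int.castRingHom (AlgebraicClosure ℚ))).IsRoot x)
    (hx' : (((integralModelInt W).preΨ' ℓ).map (Int.castRingHom (AlgebraicClosure ℚ))).IsRoot x')
    (hne : x ≠ x') : (placeOver ℓ).valuation (x - x') = (placeOver ℓ).valuation x := by
  have hp : ℓ.Prime := Fact.out
  set v := (placeOver ℓ).valuation with hv
  set F := ((integralModelInt W).preΨ' ℓ).map (Int.castRingHom (AlgebraicClosure ℚ)) with hF
  set d := (ℓ ^ 2 - 1) / 2 with hd
  obtain ⟨hdeg, hlead⟩ := natDegree_preΨ'_map_eq ℓ (W := W) hℓ2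
  have hdegF : F.natDegree = d := by rw [hF, hd]; exact hdeg
  obtain ⟨hx1, hxd⟩ := valuation_pow_mul_eq_one_of_isRoot ℓ hΔ hss hℓ2 hx
  have hd2 : 2 ≤ d := by
    have h3 : 3 ≤ ℓ := by have := hp.two_le; omega
    have : 9 ≤ ℓ ^ 2 := by nlinarith
    rw [hd]; omega
  have hvℓ : v ℓ < 1 := valuation_placeOver_natCast_lt_one ℓ
  have hvℓ0 : v ℓ ≠ 0 := by
    rw [hv, Valuation.ne_zero_iff]; exact_mod_cast hp.ne_zero
  have hxne : v x ≠ 0 := by rintro h; rw [h] at hx1; exact not_lt_zero hx1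
  have hcoeff : ∀ i, F.coeff i = (((integralModelInt W).preΨ' ℓ).coeff i : AlgebraicClosure ℚ) :=
    fun i ↦ by rw [hF, coeff_map, eq_intCast]
  have hvi : ∀ i, i ≠ 0 → v (F.coeff i) ≤ v ℓ := by
    intro i hi
    obtain ⟨m, hm⟩ := dvd_coeff_preΨ' ℓ hΔ hss hi
    rw [hcoeff, hm, Int.cast_mul, Int.cast_natCast, map_mul]
    conv_rhs => rw [← mul_one (v ℓ)]
    gcongr
    rcases em ((ℓ : ℤ) ∣ m) with h | h
    · exact ((valuation_placeOver_intCast_lt_one_iff ℓ).mpr h).le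
    · exact (valuation_placeOver_intCast_eq_one ℓ h).le
  have hvnat : ∀ n : ℕ, v (n : AlgebraicClosure ℚ) ≤ 1 := by
    intro n
    rcases em ((ℓ : ℤ) ∣ (n : ℤ)) with h | h
    · have := (valuation_placeOver_intCast_lt_one_iff ℓ).mpr h
      rw [Int.cast_natCast] at this
      exact this.le
    · have := valuation_placeOver_intCast_eq_one ℓ h
      rw [Int.cast_natCast] at this
      exact this.le
  -- all roots have the same valuation
  have hd0 : d ≠ 0 := by omega
  have hsame : ∀ {z}, F.IsRoot z → v z = v x := by
    intro z hz
    obtain ⟨-, hzd⟩ := valuation_pow_mul_eq_one_of_isRoot ℓ hΔ hss hℓ2 hz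
    exact pow_left_injective_of_ne_zero hd0 (mul_right_cancel₀ hvℓ0 (hzd.trans hxd.symm))
  -- `F = ℓ ∏ (X - s)` over its roots; `x`, `x'` among them
  have hF0 : F ≠ 0 := by
    intro h0; rw [h0, natDegree_zero] at hdegF; omega
  have hlc : F.leadingCoeff = ℓ := by rw [leadingCoeff, hdegF]; exact hlead
  have hsplit : F = C F.leadingCoeff * (F.roots.map (X - C ·)).prod :=
    (IsAlgClosed.splits F).eq_prod_roots
  have hxr : x ∈ F.roots := (mem_roots hF0).mpr hx
  have hx'r : x' ∈ F.roots := (mem_roots hF0).mpr hx'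
  have hcard : F.roots.card = d := by
    rw [← hdegF]; exact splits_iff_card_roots.mp (IsAlgClosed.splits F)
  set S := F.roots.erase x with hS
  have hx'S : x' ∈ S := (Multiset.mem_erase_of_ne hne.symm).mpr hx'r
  have hScard : S.card = d - 1 := by rw [hS, Multiset.card_erase_of_mem hxr, hcard]; rfl
  have hSroot : ∀ s ∈ S, F.IsRoot s := fun s hs ↦
    (mem_roots hF0).mp (Multiset.mem_of_mem_erase hs)
  -- `ψ_ℓ'(x) = ℓ ∏_{s ∈ S} (x - s)`
  have hder : F.derivative.eval x = ℓ * (S.map (x - ·)).prod := by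
    conv_lhs => rw [hsplit, derivative_C_mul, eval_mul, eval_C, hlc]
    rw [eval_multiset_prod_X_sub_C_derivative hxr]
  -- `v(ψ_ℓ'(x)) = v(ℓ) v(x)^{d-1}` termwise
  have hder' : v (F.derivative.eval x) = v ℓ * v x ^ (d - 1) := by
    have hnat : F.derivative.natDegree < d :=
      (natDegree_derivative_le F).trans_lt (by rw [hdegF]; omega)
    rw [eval_eq_sum_range' hnat]
    simp_rw [coeff_derivative]
    obtain ⟨d', hd'⟩ : ∃ d', d = d' + 1 := ⟨d - 1, by omega⟩
    rw [hd', Finset.sum_range_succ, Nat.add_sub_cancel]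
    have hleadF : F.coeff d = ℓ := by rw [hF, hd]; exact hlead
    have hlast : v (F.coeff (d' + 1) * ((d' : AlgebraicClosure ℚ) + 1) * x ^ d') =
        v ℓ * v x ^ d' := by
      have hdℓ : ¬ (ℓ : ℤ) ∣ ((d' + 1 : ℕ) : ℤ) := by
        intro h
        have h2 : (ℓ : ℤ) ∣ 2 * ((d' + 1 : ℕ) : ℤ) + 1 := by
          have : 2 * ((d' + 1 : ℕ) : ℤ) + 1 = ((ℓ ^ 2 : ℕ) : ℤ) := by
            have hodd : ¬ Even ℓ := fun h ↦ hℓ2 ((hp.even_iff).mp h)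
            have hodd2 : ℓ ^ 2 % 2 = 1 := by
              rcases Nat.even_or_odd ℓ with he | ho
              · exact absurd he hodd
              · exact Nat.odd_iff.mp (ho.pow)
            have : 2 * d + 1 = ℓ ^ 2 := by rw [hd]; omega
            rw [← hd']; exact_mod_cast this
          rw [this]; push_cast
          exact dvd_pow_self _ two_ne_zero
        have h3 : (ℓ : ℤ) ∣ 1 := by
          have := (Int.dvd_add_right (dvd_mul_of_dvd_right h 2)).mp h2
          exact this
        exact hp.one_lt.ne' (by exact_mod_cast Int.eq_one_of_dvd_one (by positivity) h3)
      have hvd1 : v ((d' : AlgebraicClosure ℚ) + 1) = 1 := by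
        have := valuation_placeOver_intCast_eq_one ℓ hdℓ
        push_cast at this
        exact this
      have h1 : F.coeff (d' + 1) = ℓ := by rw [← hd']; exact hleadF
      rw [h1, map_mul, map_mul, map_pow, hvd1, mul_one]
    have hrest :
        v (∑ i ∈ Finset.range d', F.coeff (i + 1) * ((i : AlgebraicClosure ℚ) + 1) * x ^ i) <
        v ℓ * v x ^ d' := by
      refine Valuation.map_sum_lt _ (mul_ne_zero hvℓ0 (pow_ne_zero _ hxne)) fun i hi ↦ ?_
      rw [Finset.mem_range] at hi
      rw [map_mul, map_mul, map_pow]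
      have hi1 : v ((i : AlgebraicClosure ℚ) + 1) ≤ 1 := by
        have := hvnat (i + 1); push_cast at this; exact this
      calc v (F.coeff (i + 1)) * v ((i : AlgebraicClosure ℚ) + 1) * v x ^ i
          ≤ v ℓ * 1 * v x ^ i := by gcongr; exact hvi _ i.succ_ne_zero
        _ = v ℓ * v x ^ i := by rw [mul_one]
        _ < v ℓ * v x ^ d' := mul_lt_mul_left_of_ne_zero hvℓ0 (pow_lt_pow_right₀ hx1 hi)
    rw [Valuation.map_add_eq_of_lt_right _ (by rw [hlast]; exact hrest), hlast]
  -- compare: `∏_{s ∈ S} v(x - s) = v(x)^{d-1}` with all factors `≤ v x`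
  have hprod : (S.map fun s ↦ v (x - s)).prod = v x ^ (d - 1) := by
    have h1 : v (F.derivative.eval x) = v ℓ * (S.map fun s ↦ v (x - s)).prod := by
      rw [hder, map_mul, map_multiset_prod, Multiset.map_map]
      rfl
    exact mul_left_cancel₀ hvℓ0 (h1.symm.trans hder')
  have hle : ∀ s ∈ S, v (x - s) ≤ v x := fun s hs ↦ by
    calc v (x - s) ≤ max (v x) (v s) := Valuation.map_sub _ _ _
      _ = v x := by rw [hsame (hSroot s hs), max_self]
  -- if `v (x - x') < v x` the product would be too small
  refine le_antisymm (hle x' hx'S) (not_lt.mp fun hlt ↦ ?_)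
  set T := S.map fun s ↦ v (x - s) with hT
  have hxT : v (x - x') ∈ T := Multiset.mem_map_of_mem _ hx'S
  have hTle : ∀ t ∈ T.erase (v (x - x')), t ≤ v x := by
    intro t ht
    obtain ⟨s, hs, rfl⟩ := Multiset.mem_map.mp (Multiset.mem_of_mem_erase ht)
    exact hle s hs
  have hTcard : (T.erase (v (x - x'))).card = d - 2 := by
    rw [Multiset.card_erase_of_mem hxT, hT, Multiset.card_map, hScard]; rfl
  have hbound : T.prod < v x ^ (d - 1) := by
    rw [← Multiset.prod_erase hxT]
    calc v (x - x') * (T.erase (v (x - x'))).prod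
        ≤ v (x - x') * v x ^ (d - 2) := by
          gcongr
          simpa only [hTcard] using Multiset.prod_le_pow_card _ _ hTle
      _ < v x * v x ^ (d - 2) := by
          rw [mul_comm (v (x - x')), mul_comm (v x)]
          exact mul_lt_mul_left_of_ne_zero (pow_ne_zero _ hxne) hlt
      _ = v x ^ (d - 1) := by rw [← pow_succ']; congr 1; omega
  exact hbound.ne hprod

end Roots

end Literature.NumberTheory.EllipticCurves
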